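import Literature.NumberTheory.EllipticCurves.Sprung2017.SharpFlatPAdicLFunctionUniqueProofs
import Literature.NumberTheory.EllipticCurves.GreenbergVatsal2000.MultiplicativeReduction
import Summits.BirchSwinnertonDyer.Rank1Residual.X11a.MuLambdaSplit
import Summits.BirchSwinnertonDyer.Rank1Residual.Supersingular.SignedMuVanishing
import Mathlib.RingTheory.Polynomial.Cyclotomic.Expand
import Mathlib.NumberTheory.Padics.RingHoms
import HarnessLib

/-!
# Sprung pairs attached to mod-`(p, ω_n)`-congruent Mazur–Tate data are congruent mod `pΛ` — the Λ-lemma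
# behind the analytic ♯/♭ ↔ ± transfer (route `SignedLowerHalves`, crux `SprungLowerHalfAtThree` = item
# stmt-BirchSwinnertonDyer-19003; cell `bsd-ssimc`, seat `bsd-ssimc-k3-c5` gen 6, object «L5-AN», ruling
# D21-1; part 1 of 2; a `--supports … --as helper` file, closes nothing)

PARTITION (cell bsd-ssimc): X8 (A8) × the 61 non-surjective (3Nn) window cells = crux 5's line of record
L5-CM (p427325) and, at `a₁ = a₂ = 0`, item 4's L4-CM — types-the-object-of; closes NONE; nothing booked;
BSD is not proved by any of this. THEOREMS ONLY (no `def`, no named fact, no PRE binder); pure algebra of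
`Λ = ℤ_p⟦T⟧`; nothing about any curve is asserted. Part 2 (`…ChromaticCongruenceTransfer.lean`) applies
this to two Sprung pairs (`IsSprungPair`) and a displayed congruence of Σ-imprimitive Mazur–Tate elements.

## What is proved (namespace `…Theorems.ChromaticCongruence`)

* §1 reduction `Λ → 𝔽_p⟦T⟧` (`PowerSeries.map PadicInt.toZMod`): `ḡ = 0 ↔ p ∣ g` (`map_toZMod_eq_zero_iff`),
  `ω_n ↦ T^{pⁿ}` (`map_toZMod_cyclotomicOmega`), `Φ_{p^{k+1}}(1+T) ↦ T^{p^{k+1} − p^k}`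
  (`map_toZMod_cyclotomic_comp`, Mathlib `cyclotomic_mul_prime_pow_eq` in characteristic `p`).
* §2 Sprung's recursion `x_{n+2} = a_p x_{n+1} − Φ_{p^{n+1}}(1+T) x_n` (Sprung 2017 §4 Cor. 4.4; tree
  `sprungSeq`, `sharpPoly = u_n`, `flatPoly = v_n`) read mod `p` when `p ∣ a_p`:
  `x̄_{n+2} = −T^{p^{n+1}−pⁿ}·x̄_n`; hence `ū_n(a₁) = ū_n(a₂)`, `v̄_n(a₁) = v̄_n(a₂)` for `p ∣ a₁, a₂`
  (`map_toZMod_sprungSeq_eq_of_dvd` — PROVED, as ruling D21-1 (i) asks), `ū_{2k} = v̄_{2k+1} = 0`,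
  `ū_{2k+1} = ±T^e`, `v̄_{2k} = ±T^{e'}` with `2e < pⁿ` (`map_toZMod_sharpPoly_odd`, `map_toZMod_flatPoly_even`).
* §3 **`C_dvd_sub_of_sprung_congr`**: for `p ∣ a₁`, `p ∣ a₂`, `A₁, B₁, A₂, B₂ ∈ Λ`, `c ∈ ℤ_p`, IF for all `n`
  `u_n(a₁)A₁ + v_n(a₁)B₁ − c·(u_n(a₂)A₂ + v_n(a₂)B₂) ∈ (p, ω_n)Λ` THEN `A₁ ≡ c·A₂`, `B₁ ≡ c·B₂ (mod pΛ)`.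
  Proof: at odd `n`, `±T^e·Ā ∈ (T^{pⁿ})` in the domain `𝔽_p⟦T⟧` with `pⁿ − e > pⁿ/2 → ∞`, so every
  coefficient of `Ā` vanishes; even `n` for `B̄`. (The mod-`p` shadow of the tree's `IsSprungPair.unique`,
  now for TWO traces `a₁ ≢ a₂` — e.g. `a_3(E) = ±3` vs `a_3(E′) = 0`.)
* §4 unit content (`GreenbergVatsal2000.HasUnitContent`, i.e. `μ = 0`) and `λ` (`X1.MuLambda.lam`) pass
  along `x ≡ c·y (mod p)` with `c ∈ ℤ_pˣ`: `hasUnitContent_iff_of_C_dvd_sub`, `lam_eq_of_C_dvd_sub`,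
  `hasUnitContent_mul_iff_of_hasUnitContent`.

Source of the statement shape: Corpuz–Lei, arXiv:2508.09733 (PRE) Thm. 4.5 / Thm. 5.3 prove the
congruence of Σ₀-imprimitive signed `p`-adic `L`-functions of congruent non-ordinary forms through the
Büyükboduk–Lei logarithm matrix; this file obtains the underlying Λ-statement `α`-free from the Mazur–Tate
characterisation. Nothing here is conditional. References: [Sprung2017] §4 Cor. 4.4, Thm. 1.12;
[Pollack2003] §6.5; [GreenbergVatsal2000] p. 2 (1)–(2); [CorpuzLei2025] Thm. 4.5, 5.3; Washington GTM 83
§7.1, §13.1. Memo: `HOME/bsd-ssimc-k3-c5-MEMO-6.md`.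
-/

set_option autoImplicit false
set_option linter.dupNamespace false

noncomputable section

open scoped MatrixGroups ModularForm

open CongruenceSubgroup Polynomial Literature.NumberTheory.EllipticCurves
  Literature.NumberTheory.EllipticCurves.ModularForms
  Literature.NumberTheory.EllipticCurves.Sprung2017
  Literature.NumberTheory.EllipticCurves.GreenbergVatsal2000
  Summit.BirchSwinnertonDyer.Rank1Residual.X1.MuLambda
  Summit.BirchSwinnertonDyer.Rank1Residual.X11a
  Summit.BirchSwinnertonDyer.Rank1Residual.Supersingular
  Literature.NumberTheory.EllipticCurves.Rank1Residual

namespace Summit.BirchSwinnertonDyer.BirchSwinnertonDyer.Theorems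

namespace ChromaticCongruence

variable {p : ℕ} [hp : Fact p.Prime]

/-! ### §1 Reduction modulo `p` of `Λ = ℤ_p⟦T⟧` -/

/-- `Λ → 𝔽_p⟦T⟧` kills exactly the multiples of `p`: `ḡ = 0 ↔ p ∣ g` in `Λ`. [folklore] -/
theorem map_toZMod_eq_zero_iff (g : IwasawaAlgebra p) :
    PowerSeries.map (PadicInt.toZMod (p := p)) g = 0 ↔ PowerSeries.C (p : ℤ_[p]) ∣ g := by
  rw [Literature.NumberTheory.EllipticCurves.PowerSeries.C_dvd_iff_forall_dvd_coeff]
  constructor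
  · intro h n
    have hn := congrArg (PowerSeries.coeff n) h
    rw [PowerSeries.coeff_map, map_zero] at hn
    have hmem : PowerSeries.coeff n g ∈ RingHom.ker (PadicInt.toZMod (p := p)) := hn
    rwa [PadicInt.ker_toZMod, PadicInt.maximalIdeal_eq_span_p, Ideal.mem_span_singleton] at hmem
  · intro h
    ext n
    rw [PowerSeries.coeff_map, map_zero]
    have hmem : PowerSeries.coeff n g ∈ RingHom.ker (PadicInt.toZMod (p := p)) := by
      rw [PadicInt.ker_toZMod, PadicInt.maximalIdeal_eq_span_p, Ideal.mem_span_singleton]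
      exact h n
    exact hmem

/-- `p ↦ 0` under `Λ → 𝔽_p⟦T⟧`. [folklore] -/
theorem map_toZMod_C_natCast :
    PowerSeries.map (PadicInt.toZMod (p := p)) (PowerSeries.C (p : ℤ_[p])) = 0 := by
  rw [PowerSeries.map_C, map_natCast, ZMod.natCast_self, map_zero]

/-- Reduction of a polynomial with integer coefficients viewed in `Λ`: coefficientwise `ℤ → 𝔽_p`.
[folklore] -/
theorem map_toZMod_toIwasawa (q : ℤ[X]) :
    PowerSeries.map (PadicInt.toZMod (p := p)) (toIwasawa p q) =
      ((q.map (Int.castRingHom (ZMod p)) : (ZMod p)[X]) : PowerSeries (ZMod p)) := by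
  ext n
  show PadicInt.toZMod (PowerSeries.coeff n
      (((q.map (Int.castRingHom ℤ_[p])) : ℤ_[p][X]) : PowerSeries ℤ_[p])) = _
  rw [Polynomial.coeff_coe, Polynomial.coeff_coe, Polynomial.coeff_map, Polynomial.coeff_map,
    eq_intCast, eq_intCast, map_intCast]

/-- `ω_n = (1+T)^{pⁿ} − 1 ↦ T^{pⁿ}` in `𝔽_p⟦T⟧` (Frobenius). [folklore] -/
theorem map_toZMod_cyclotomicOmega (n : ℕ) :
    PowerSeries.map (PadicInt.toZMod (p := p)) (toIwasawa p (cyclotomicOmega p n)) =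
      PowerSeries.X ^ p ^ n := by
  rw [map_toZMod_toIwasawa, cyclotomicOmega, Polynomial.map_sub, Polynomial.map_pow,
    Polynomial.map_add, Polynomial.map_X, Polynomial.map_one,
    add_pow_char_pow, one_pow, add_sub_cancel_right, Polynomial.coe_pow, Polynomial.coe_X]

/-- `Φ_{p^{k+1}}(1+T) ↦ T^{p^{k+1} − p^k}` in `𝔽_p⟦T⟧` (`Φ_{p^{k+1}} = (X − 1)^{φ(p^{k+1})}` in
characteristic `p`). [folklore] -/
theorem map_toZMod_cyclotomic_comp (k : ℕ) :
    PowerSeries.map (PadicInt.toZMod (p := p))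
        (toIwasawa p ((cyclotomic (p ^ (k + 1)) ℤ).comp (X + 1))) =
      PowerSeries.X ^ (p ^ (k + 1) - p ^ k) := by
  rw [map_toZMod_toIwasawa, Polynomial.map_comp, map_cyclotomic, Polynomial.map_add,
    Polynomial.map_X, Polynomial.map_one]
  have h1 : cyclotomic (p ^ (k + 1)) (ZMod p) = (X - 1) ^ (p ^ (k + 1) - p ^ k) := by
    have h := cyclotomic_mul_prime_pow_eq (ZMod p) (p := p) (m := 1)
      (fun h => hp.out.ne_one (Nat.dvd_one.mp h)) (k := k + 1) k.succ_pos
    rw [mul_one, cyclotomic_one, Nat.add_sub_cancel] at h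
    exact h
  rw [h1, pow_comp, sub_comp, X_comp, one_comp, add_sub_cancel_right, Polynomial.coe_pow,
    Polynomial.coe_X]

/-- `a ↦ 0` for `p ∣ a`: the constant polynomial `C a` dies in `𝔽_p⟦T⟧`. [folklore] -/
theorem map_toZMod_toIwasawa_C {a : ℤ} (ha : (p : ℤ) ∣ a) :
    PowerSeries.map (PadicInt.toZMod (p := p)) (toIwasawa p (C a)) = 0 := by
  rw [map_toZMod_toIwasawa, Polynomial.map_C, eq_intCast,
    (ZMod.intCast_zmod_eq_zero_iff_dvd a p).mpr ha, C_0, Polynomial.coe_zero]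

/-! ### §2 Sprung's recursion modulo `p` when `p ∣ a_p` -/

/-- **The recursion mod `p`.** For `p ∣ a_p`: `x̄_{n+2} = − T^{p^{n+1} − p^n} · x̄_n` in `𝔽_p⟦T⟧`
(Sprung's `x_{n+2} = a_p x_{n+1} − Φ_{p^{n+1}}(1+T) x_n` with `a_p ≡ 0` and
`Φ_{p^{n+1}}(1+T) ≡ T^{φ(p^{n+1})}`). [cite: Sprung2017, §4 Cor. 4.4] -/
theorem map_toZMod_sprungSeq_add_two {a : ℤ} (ha : (p : ℤ) ∣ a) (x₀ x₁ : ℤ[X]) (n : ℕ) :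
    PowerSeries.map (PadicInt.toZMod (p := p)) (toIwasawa p (sprungSeq a p x₀ x₁ (n + 2))) =
      -(PowerSeries.X ^ (p ^ (n + 1) - p ^ n) *
        PowerSeries.map (PadicInt.toZMod (p := p)) (toIwasawa p (sprungSeq a p x₀ x₁ n))) := by
  rw [sprungSeq_add_two, map_sub, map_mul, map_mul, map_sub, map_mul, map_mul,
    map_toZMod_toIwasawa_C ha, zero_mul, zero_sub, map_toZMod_cyclotomic_comp]

/-- Mod `p`, Sprung's sequence depends on `a_p` only through `a_p mod p`: two traces divisible by
`p` give the same reductions. [cite: Sprung2017, §4 Cor. 4.4] -/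
theorem map_toZMod_sprungSeq_eq_of_dvd {a₁ a₂ : ℤ} (h₁ : (p : ℤ) ∣ a₁) (h₂ : (p : ℤ) ∣ a₂)
    (x₀ x₁ : ℤ[X]) (n : ℕ) :
    PowerSeries.map (PadicInt.toZMod (p := p)) (toIwasawa p (sprungSeq a₁ p x₀ x₁ n)) =
      PowerSeries.map (PadicInt.toZMod (p := p)) (toIwasawa p (sprungSeq a₂ p x₀ x₁ n)) := by
  -- two-step induction: the statement for `n` and `n + 1` together
  suffices h : ∀ m : ℕ,
      PowerSeries.map (PadicInt.toZMod (p := p)) (toIwasawa p (sprungSeq a₁ p x₀ x₁ m)) =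
        PowerSeries.map (PadicInt.toZMod (p := p)) (toIwasawa p (sprungSeq a₂ p x₀ x₁ m)) ∧
      PowerSeries.map (PadicInt.toZMod (p := p)) (toIwasawa p (sprungSeq a₁ p x₀ x₁ (m + 1))) =
        PowerSeries.map (PadicInt.toZMod (p := p)) (toIwasawa p (sprungSeq a₂ p x₀ x₁ (m + 1))) from
    (h n).1
  intro m
  induction m with
  | zero => exact ⟨rfl, rfl⟩
  | succ m ih =>
    refine ⟨ih.2, ?_⟩
    rw [map_toZMod_sprungSeq_add_two h₁, map_toZMod_sprungSeq_add_two h₂, ih.1]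

/-- `ū_{2k} = 0` (for `p ∣ a_p`). [cite: Sprung2017, §4 Cor. 4.4] -/
theorem map_toZMod_sharpPoly_even {a : ℤ} (ha : (p : ℤ) ∣ a) (k : ℕ) :
    PowerSeries.map (PadicInt.toZMod (p := p)) (toIwasawa p (sharpPoly a p (2 * k))) = 0 := by
  induction k with
  | zero => simp [sharpPoly]
  | succ k ih =>
    rw [show 2 * (k + 1) = 2 * k + 2 by ring, sharpPoly, map_toZMod_sprungSeq_add_two ha]
    rw [sharpPoly] at ih
    rw [ih, mul_zero, neg_zero]

/-- `v̄_{2k+1} = 0` (for `p ∣ a_p`). [cite: Sprung2017, §4 Cor. 4.4] -/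
theorem map_toZMod_flatPoly_odd {a : ℤ} (ha : (p : ℤ) ∣ a) (k : ℕ) :
    PowerSeries.map (PadicInt.toZMod (p := p)) (toIwasawa p (flatPoly a p (2 * k + 1))) = 0 := by
  induction k with
  | zero => simp [flatPoly]
  | succ k ih =>
    rw [show 2 * (k + 1) + 1 = (2 * k + 1) + 2 by ring, flatPoly, map_toZMod_sprungSeq_add_two ha]
    rw [flatPoly] at ih
    rw [ih, mul_zero, neg_zero]

/-- Arithmetic of the exponents: `2(p^{n+1} − p^n + e) < p^{n+2}` when `2e < p^n`. [folklore] -/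
private theorem two_mul_exp_lt {n e : ℕ} (he : 2 * e < p ^ n) :
    2 * (p ^ (n + 1) - p ^ n + e) < p ^ (n + 2) := by
  have h2 : 2 ≤ p := hp.out.two_le
  have hA : p ^ n ≤ p ^ (n + 1) := Nat.pow_le_pow_right hp.out.pos (Nat.le_succ n)
  have hB : 2 * p ^ (n + 1) ≤ p ^ (n + 2) := by
    rw [pow_succ p (n + 1)]
    calc 2 * p ^ (n + 1) ≤ p * p ^ (n + 1) := Nat.mul_le_mul_right _ h2
      _ = p ^ (n + 1) * p := by ring
  omega

/-- `ū_{2k+1} = ± T^{e}` with `2e < p^{2k+1}` (for `p ∣ a_p`; `e = ∑_{i ≤ k} φ(p^{2i})`, i.e.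
`ū_{2k+1} = ± ω̄⁺_{2k+1}`). [cite: Sprung2017, §4 Cor. 4.4] -/
theorem map_toZMod_sharpPoly_odd {a : ℤ} (ha : (p : ℤ) ∣ a) (k : ℕ) :
    ∃ e : ℕ, 2 * e < p ^ (2 * k + 1) ∧
      (PowerSeries.map (PadicInt.toZMod (p := p)) (toIwasawa p (sharpPoly a p (2 * k + 1))) =
          PowerSeries.X ^ e ∨
        PowerSeries.map (PadicInt.toZMod (p := p)) (toIwasawa p (sharpPoly a p (2 * k + 1))) =
          -PowerSeries.X ^ e) := by
  induction k with
  | zero =>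
    refine ⟨0, by simpa using hp.out.pos, Or.inl ?_⟩
    simp [sharpPoly]
  | succ k ih =>
    obtain ⟨e, he, hshape⟩ := ih
    refine ⟨p ^ (2 * k + 2) - p ^ (2 * k + 1) + e, ?_, ?_⟩
    · have := two_mul_exp_lt (n := 2 * k + 1) he
      rw [show 2 * (k + 1) + 1 = 2 * k + 1 + 2 by ring]
      exact this
    · rw [show 2 * (k + 1) + 1 = (2 * k + 1) + 2 by ring, sharpPoly, map_toZMod_sprungSeq_add_two ha]
      rw [sharpPoly] at hshape
      rcases hshape with h | h
      · right
        rw [h, ← pow_add]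
      · left
        rw [h, mul_neg, neg_neg, ← pow_add]

/-- `v̄_{2k} = ± T^{e}` with `2e < p^{2k}` (for `p ∣ a_p`; `v̄_{2k} = ± ω̄⁻_{2k}`). [cite: Sprung2017, §4 Cor. 4.4] -/
theorem map_toZMod_flatPoly_even {a : ℤ} (ha : (p : ℤ) ∣ a) (k : ℕ) :
    ∃ e : ℕ, 2 * e < p ^ (2 * k) ∧
      (PowerSeries.map (PadicInt.toZMod (p := p)) (toIwasawa p (flatPoly a p (2 * k))) =
          PowerSeries.X ^ e ∨
        PowerSeries.map (PadicInt.toZMod (p := p)) (toIwasawa p (flatPoly a p (2 * k))) =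
          -PowerSeries.X ^ e) := by
  induction k with
  | zero =>
    refine ⟨0, by simp, Or.inl ?_⟩
    simp [flatPoly]
  | succ k ih =>
    obtain ⟨e, he, hshape⟩ := ih
    refine ⟨p ^ (2 * k + 1) - p ^ (2 * k) + e, ?_, ?_⟩
    · have := two_mul_exp_lt (n := 2 * k) he
      rw [show 2 * (k + 1) = 2 * k + 2 by ring]
      exact this
    · rw [show 2 * (k + 1) = 2 * k + 2 by ring, flatPoly, map_toZMod_sprungSeq_add_two ha]
      rw [flatPoly] at hshape
      rcases hshape with h | h
      · right
        rw [h, ← pow_add]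
      · left
        rw [h, mul_neg, neg_neg, ← pow_add]


/-! ### §3 The abstract congruence lemma in `Λ` -/

/-- `2j < p^{2j+1}` and `2j < p^{2j+2}` (room for the coefficient index). [folklore] -/
private theorem two_mul_lt_pow (j i : ℕ) : 2 * j < p ^ (2 * j + 1 + i) := by
  have h2 : 2 ≤ p := hp.out.two_le
  have hj : j < 2 ^ j := Nat.lt_two_pow_self
  calc 2 * j < 2 * 2 ^ j := by omega
    _ = 2 ^ (j + 1) := by ring
    _ ≤ 2 ^ (2 * j + 1 + i) := Nat.pow_le_pow_right (by norm_num) (by omega)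
    _ ≤ p ^ (2 * j + 1 + i) := Nat.pow_le_pow_left h2 _

/-- From `±T^e · Ā = T^{N} · q̄` with `2e < N` and `2j < N` in the domain `𝔽_p⟦T⟧`: the `j`-th
coefficient of `Ā` vanishes. [folklore] -/
private theorem coeff_eq_zero_of_X_pow_mul_eq {e N j : ℕ} (he : 2 * e < N) (hj : 2 * j < N)
    {U A q : PowerSeries (ZMod p)} (hU : U = PowerSeries.X ^ e ∨ U = -PowerSeries.X ^ e)
    (h : U * A = PowerSeries.X ^ N * q) : PowerSeries.coeff j A = 0 := by
  obtain ⟨m, hm⟩ : ∃ m, N = e + m := ⟨N - e, by omega⟩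
  have hjm : j < m := by omega
  have hXe : (PowerSeries.X : PowerSeries (ZMod p)) ^ e ≠ 0 := pow_ne_zero e PowerSeries.X_ne_zero
  have hdvd : PowerSeries.X ^ m ∣ A := by
    rcases hU with hU | hU
    · rw [hU, hm, pow_add, mul_assoc] at h
      exact ⟨q, mul_left_cancel₀ hXe h⟩
    · rw [hU, hm, pow_add, mul_assoc, neg_mul, neg_eq_iff_eq_neg, ← mul_neg, ← mul_neg] at h
      exact ⟨-q, mul_left_cancel₀ hXe h⟩
  exact (PowerSeries.X_pow_dvd_iff.mp hdvd) j hjm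

/-- **Sprung pairs are determined mod `p` by the Mazur–Tate data mod `(p, ω_n)`.** Let `p ∣ a₁`,
`p ∣ a₂` (both traces supersingular) and `A₁, B₁, A₂, B₂ ∈ Λ = ℤ_p⟦T⟧`, `c ∈ ℤ_p`. If for every `n`
`u_n(a₁)·A₁ + v_n(a₁)·B₁ ≡ c·(u_n(a₂)·A₂ + v_n(a₂)·B₂)  (mod (p, ω_n)Λ)`
(`u_n = sharpPoly`, `v_n = flatPoly`, `ω_n = cyclotomicOmega`), then `A₁ ≡ c·A₂` and `B₁ ≡ c·B₂ (mod pΛ)`.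
Proof in `𝔽_p⟦T⟧`: `ω_n ↦ T^{pⁿ}`, `u_n(aᵢ) ↦ ū_n`, `v_n(aᵢ) ↦ v̄_n` (independent of `aᵢ ≡ 0`), with
`ū_{2k} = v̄_{2k+1} = 0`, `ū_{2k+1} = ±T^{e}`, `v̄_{2k} = ±T^{e'}`, `2e, 2e' < pⁿ`; so `T^e·Ā ∈ (T^{pⁿ})`
for all odd `n`, forcing `Ā = 0`, and likewise `B̄ = 0`. This is the `α`-free core of the analytic
`μ`-transfer between congruent forms with DIFFERENT `a_p` (Corpuz–Lei, arXiv:2508.09733, Thm. 1 /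
Thm. 5.3, there proved through Büyükboduk–Lei logarithm matrices), read on Sprung's Mazur–Tate
characterisation of `(L♯, L♭)`. [cite: Sprung2017, §4 Cor. 4.4 and Thm. 1.12] -/
theorem C_dvd_sub_of_sprung_congr {a₁ a₂ : ℤ} (ha₁ : (p : ℤ) ∣ a₁) (ha₂ : (p : ℤ) ∣ a₂)
    {A₁ B₁ A₂ B₂ : IwasawaAlgebra p} (c : ℤ_[p])
    (H : ∀ n : ℕ, ∃ q r : IwasawaAlgebra p,
      toIwasawa p (sharpPoly a₁ p n) * A₁ + toIwasawa p (flatPoly a₁ p n) * B₁ -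
          PowerSeries.C c *
            (toIwasawa p (sharpPoly a₂ p n) * A₂ + toIwasawa p (flatPoly a₂ p n) * B₂) =
        toIwasawa p (cyclotomicOmega p n) * q + PowerSeries.C (p : ℤ_[p]) * r) :
    PowerSeries.C (p : ℤ_[p]) ∣ (A₁ - PowerSeries.C c * A₂) ∧
      PowerSeries.C (p : ℤ_[p]) ∣ (B₁ - PowerSeries.C c * B₂) := by
  set Abar := PowerSeries.map (PadicInt.toZMod (p := p)) (A₁ - PowerSeries.C c * A₂) with hAbar
  set Bbar := PowerSeries.map (PadicInt.toZMod (p := p)) (B₁ - PowerSeries.C c * B₂) with hBbar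
  -- Step 1: reduce the hypothesis mod `p`
  have key : ∀ n : ℕ, ∃ qbar : PowerSeries (ZMod p),
      PowerSeries.map (PadicInt.toZMod (p := p)) (toIwasawa p (sharpPoly a₂ p n)) * Abar +
          PowerSeries.map (PadicInt.toZMod (p := p)) (toIwasawa p (flatPoly a₂ p n)) * Bbar =
        PowerSeries.X ^ p ^ n * qbar := by
    intro n
    obtain ⟨q, r, h⟩ := H n
    refine ⟨PowerSeries.map (PadicInt.toZMod (p := p)) q, ?_⟩
    have h' := congrArg (PowerSeries.map (PadicInt.toZMod (p := p))) h
    simp only [map_add, map_sub, map_mul, map_toZMod_cyclotomicOmega, map_toZMod_C_natCast,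
      zero_mul, add_zero, sharpPoly, flatPoly] at h'
    rw [map_toZMod_sprungSeq_eq_of_dvd ha₁ ha₂ 0 1 n,
      map_toZMod_sprungSeq_eq_of_dvd ha₁ ha₂ 1 0 n] at h'
    simp only [hAbar, hBbar, map_sub, map_mul, sharpPoly, flatPoly]
    linear_combination h'
  -- Step 2: `Ā = 0` from the odd levels, `B̄ = 0` from the even levels
  have hA : Abar = 0 := by
    ext j
    rw [map_zero]
    obtain ⟨e, he, hu⟩ := map_toZMod_sharpPoly_odd ha₂ j
    have hv := map_toZMod_flatPoly_odd ha₂ j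
    obtain ⟨qbar, hq⟩ := key (2 * j + 1)
    rw [hv, zero_mul, add_zero] at hq
    exact coeff_eq_zero_of_X_pow_mul_eq he (by simpa using two_mul_lt_pow j 0) hu hq
  have hB : Bbar = 0 := by
    ext j
    rw [map_zero]
    obtain ⟨e, he, hv⟩ := map_toZMod_flatPoly_even ha₂ (j + 1)
    have hu := map_toZMod_sharpPoly_even ha₂ (j + 1)
    obtain ⟨qbar, hq⟩ := key (2 * (j + 1))
    rw [hu, zero_mul, zero_add] at hq
    have hj : 2 * j < p ^ (2 * (j + 1)) := by
      have := two_mul_lt_pow (p := p) j 1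
      rwa [show 2 * j + 1 + 1 = 2 * (j + 1) by ring] at this
    exact coeff_eq_zero_of_X_pow_mul_eq he hj hv hq
  exact ⟨(map_toZMod_eq_zero_iff _).mp hA, (map_toZMod_eq_zero_iff _).mp hB⟩

/-! ### §4 Unit content (`μ = 0`) and `λ` along a mod-`p` congruence -/

/-- **Unit content passes along `x ≡ c·y (mod p)` with `c ∈ ℤ_pˣ`** (`x̄ = c̄·ȳ` in the domain
`𝔽_p⟦T⟧`, `c̄ ≠ 0`). [cite: GreenbergVatsal2000, p. 2, (2)] -/
theorem hasUnitContent_iff_of_C_dvd_sub {x y : IwasawaAlgebra p} {c : ℤ_[p]} (hc : IsUnit c)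
    (h : PowerSeries.C (p : ℤ_[p]) ∣ (x - PowerSeries.C c * y)) :
    HasUnitContent x ↔ HasUnitContent y := by
  rw [hasUnitContent_iff_map_toZMod_ne_zero, hasUnitContent_iff_map_toZMod_ne_zero]
  have h0 := (map_toZMod_eq_zero_iff _).mpr h
  rw [map_sub, map_mul, PowerSeries.map_C, sub_eq_zero] at h0
  have hcu : (PowerSeries.C (PadicInt.toZMod (p := p) c) : PowerSeries (ZMod p)) ≠ 0 := by
    intro h1
    have h2 : PadicInt.toZMod (p := p) c = 0 := by
      have := congrArg PowerSeries.constantCoeff h1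
      simpa using this
    exact (hc.map (PadicInt.toZMod (p := p))).ne_zero h2
  rw [h0, mul_ne_zero_iff, and_iff_right hcu]

/-- Unit content of `x·P` is unit content of `x` when `P` has unit content (`𝔽_p⟦T⟧` is a domain).
[cite: GreenbergVatsal2000, p. 2, (2)] -/
theorem hasUnitContent_mul_iff_of_hasUnitContent {x P : IwasawaAlgebra p} (hP : HasUnitContent P) :
    HasUnitContent (x * P) ↔ HasUnitContent x := by
  rw [hasUnitContent_iff_map_toZMod_ne_zero] at hP
  rw [hasUnitContent_iff_map_toZMod_ne_zero, hasUnitContent_iff_map_toZMod_ne_zero, map_mul,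
    mul_ne_zero_iff, and_iff_left hP]

/-- For power series of unit content, `λ` (order of the reduction mod `p`) depends only on the
reduction mod `p`. [cite: GreenbergVatsal2000, p. 2–3, (1)–(2)] -/
theorem lam_eq_of_red_eq {x y : IwasawaAlgebra p} (hx : HasUnitContent x) (hy : HasUnitContent y)
    (h : red x = red y) : lam x = lam y := by
  have hx0 : red x ≠ 0 := fun h0 => ((hasUnitContent_iff_not_C_dvd x).mp hx) ((red_eq_zero_iff x).mp h0)
  have hy0 : red y ≠ 0 := fun h0 => ((hasUnitContent_iff_not_C_dvd y).mp hy) ((red_eq_zero_iff y).mp h0)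
  have hpx : pfree x = x := (mu_eq_and_pfree_eq (g := x) (a := 0) hx0 (by simp)).2
  have hpy : pfree y = y := (mu_eq_and_pfree_eq (g := y) (a := 0) hy0 (by simp)).2
  rw [lam, lam, hpx, hpy, h]

/-- **`λ` passes along `x ≡ c·y (mod p)` with `c ∈ ℤ_pˣ` when `μ = 0`.**
[cite: GreenbergVatsal2000, p. 2–3, (1)–(2)] -/
theorem lam_eq_of_C_dvd_sub {x y : IwasawaAlgebra p} {c : ℤ_[p]} (hc : IsUnit c)
    (h : PowerSeries.C (p : ℤ_[p]) ∣ (x - PowerSeries.C c * y)) (hx : HasUnitContent x) :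
    lam x = lam y := by
  have hy : HasUnitContent y := (hasUnitContent_iff_of_C_dvd_sub hc h).mp hx
  have hCc : IsUnit (PowerSeries.C c : IwasawaAlgebra p) := hc.map PowerSeries.C
  have hcy : HasUnitContent (PowerSeries.C c * y) := (hasUnitContent_unit_mul_iff hCc y).mpr hy
  have hred : red x = red (PowerSeries.C c * y) := by
    rw [← sub_eq_zero, ← map_sub]
    exact (red_eq_zero_iff _).mpr h
  rw [lam_eq_of_red_eq hx hcy hred, lam_mul hCc.ne_zero (ne_zero_of_hasUnitContent hy),
    ((isUnit_iff_mu_eq_zero_and_lam_eq_zero _).mp hCc).2.2, zero_add]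

end ChromaticCongruence

end Summit.BirchSwinnertonDyer.BirchSwinnertonDyer.Theorems

end
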